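import Summits.BirchSwinnertonDyer.BirchSwinnertonDyer.Theorems.KolyvaginRoadThreeZhangSupplyEngineOfPoitouTate
import Summits.BirchSwinnertonDyer.BirchSwinnertonDyer.Theorems.KolyvaginRoadThreeMethod2KolyvaginIsoBound
import HarnessLib

/-!
# KOLY method line, crux stmt-BirchSwinnertonDyer-19574 `ZhangSharpFrameAtThreeHL`: the registered S2-ENGINE stub
# `stub_inductionOfLevelSystemsAtThree` FROM THE POITOU–TATE FACT ALONE
# (cell `bsd-stepL`, seat `bsd-stepL-zhang3-p1` g10; `--supports 19574`, helper)

HONEST FRAMING. Composition only; 0 definitions, 0 named facts, 0 `sorry`; closes nothing (T7) — the crux is NOT claimed,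
and the stub lands CONDITIONALLY: `Method2.stub_inductionOfLevelSystemsAtThree_of_poitouTate (hPT)` is the registered
S2-ENGINE text (skeleton v3 `Cruxes/ZhangSharpFrameAtThreeHL/Lines/method2.lean`, sha16 90adda8cb9c1bade) VERBATIM as
conclusion, from the single PUBLISHED named fact `poitouTate_selmerStructure_duality K` for imaginary quadratic `K`
(Poitou–Tate duality for Selmer structures: Milne ADT I Thm. 4.10, Howard 2004 Thm. 2.1.11; a Literature `def … : Prop`,
unproved in the tree; the registered stub text has no slot for it). PARTITION: O2@3 (B10) × A1 × crux 19574 × stub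
S2-ENGINE — proves-glue.

WHAT. koly3b g6's `ZhangSupply.stub_inductionOfLevelSystemsAtThree_of_poitouTate_of_rigidity (hPT) (hRig)` (part XXVI:
the OWNER's `inductionOfLevelSystems_of_triangulation` ∘ this seat's `Method2.triangulation_of_supply` ∘ koly3b's
`hSupply_of_poitouTate`) with its second hypothesis — the local line-rigidity at Kolyvagin primes in cup-product currency
— DISCHARGED by this seat's `KolyLocal.sub_zsmul_mem_torsionLocalKer_of_isotropic` (`…Method2KolyvaginIsoBound`). So, in
the kernel: S2-ENGINE ⟸ Poitou–Tate duality for Selmer structures, nothing else.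
[cite: WZhang2014, §9 proof of Thm. 9.1, Lemma 8.2, Lemma 8.4] [cite: MilneADT2006, Ch. I, Thm. 4.10]
[cite: GrossLMS1991, Prop. 8.1–8.2, 9.6]
-/

noncomputable section

open scoped Classical

namespace Summit.BirchSwinnertonDyer.Rank1Residual.X11b.Three.Koly.Method2

open CategoryTheory WeierstrassCurve NumberField IsDedekindDomain Field
  Literature.NumberTheory.EllipticCurves Literature.NumberTheory.EllipticCurves.ModularForms
  Literature.NumberTheory.GaloisRepresentations Module
open Literature.NumberTheory.GaloisCohomology

/-- **The S2-ENGINE stub from the Poitou–Tate fact.** The registered text of `stub_inductionOfLevelSystemsAtThree`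
(skeleton v3) VERBATIM as conclusion — at every Hoffstein–Luo A1 frame, a level Kolyvagin system, (A1) at the frame, and
`dim_𝔽₃ Sel₃(E/K)` odd and `≥ 3` give a non-zero Kolyvagin class with Kolyvagin-prime support — from
`hPT : poitouTate_selmerStructure_duality K` for imaginary quadratic `K` ONLY: koly3b's
`ZhangSupply.stub_inductionOfLevelSystemsAtThree_of_poitouTate_of_rigidity` with the local rigidity `hRig` supplied by
`KolyLocal.sub_zsmul_mem_torsionLocalKer_of_isotropic`. CONDITIONAL on `hPT`; nothing is booked.
[cite: WZhang2014, §9 proof of Thm. 9.1, Lemma 8.4] [cite: MilneADT2006, Ch. I, Thm. 4.10] [cite: GrossLMS1991, Prop. 8.1–8.2] -/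
theorem stub_inductionOfLevelSystemsAtThree_of_poitouTate
    (hPT : ∀ (K : Type) [Field K] [NumberField K], IsImaginaryQuadratic K → poitouTate_selmerStructure_duality K) :
    ∀ (W : WeierstrassCurve ℚ) [W.IsElliptic] [W.IsGloballyMinimal] [NeZero (W.conductorNorm ℤ)] (K : Type)
      [Field K] [NumberField K] (Dt : ModularParametrizationData W (W.conductorNorm ℤ)) (β : ℤ) (ι : K →+* ℂ),
      Summit.BirchSwinnertonDyer.Rank1Residual.ClassX11b W 3 → W.HasMultiplicativeReductionAtPrime 3 →
      Rank1Residual.Surj W 3 → Rank1Residual.Ram W 3 → ¬ 3 ∣ W.tamagawaProduct → IsImaginaryQuadratic K →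
      Odd (NumberField.discr K) → SatisfiesHeegnerHypothesis (W.conductorNorm ℤ) K →
      (W.quadraticTwist (NumberField.discr K : ℚ)).entireLFunction 1 ≠ 0 → NumberField.discr K ≠ -3 →
      (4 * (W.conductorNorm ℤ : ℤ)) ∣ β ^ 2 - NumberField.discr K → ¬ (3 : ℤ) ∣ Dt.c →
      ∀ (c : K ≃ₐ[ℚ] K), c ≠ 1 → ∀ [Module (ZMod 3) (V3 W K)],
      LevelKolyvaginSystem W K Dt β ι c →
      -- (A1) at the frame (stub A's body, verbatim) as HYPOTHESIS
      (∀ (n : Finset {q // IsUAdmissiblePrime W K q}) (μ : Bool) (x : V3 W K),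
        GoodLevel W K n → x ∈ SelQ W K c n μ → x ≠ 0 →
        ∃ q : {q // IsUAdmissiblePrime W K q}, q ∉ n ∧ GoodLevel W K (insert q n) ∧
          x ∉ SelQ W K c (insert q n) μ ∧
          SelQ W K c (insert q n) μ ≤ SelQ W K c n μ ∧
          finrank (ZMod 3) (SelQ W K c (insert q n) μ) + 1 = finrank (ZMod 3) (SelQ W K c n μ) ∧
          SelQ W K c (insert q n) (!μ) = SelQ W K c n (!μ)) →
      Odd (finrank (ZMod 3)
        (AddSubgroup.toZModSubmodule 3 (selmerGroup (W.baseChange K) ((3 ^ 1 : ℕ) : ℤ)))) →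
      3 ≤ finrank (ZMod 3)
        (AddSubgroup.toZModSubmodule 3 (selmerGroup (W.baseChange K) ((3 ^ 1 : ℕ) : ℤ))) →
      ∃ (n : ℕ) (d : KolyvaginHeegnerData Dt β ι n),
        KolyvaginDescent.KolSupp (Zhang2014.IsKolyvaginPrime (W.conductorNorm ℤ) W K 3) n ∧
          d.kolyvaginClass Nat.prime_three 1 ≠ 0 :=
  ZhangSupply.stub_inductionOfLevelSystemsAtThree_of_poitouTate_of_rigidity hPT (by
    intro W _ _ K _ _ hK hsurj _ hc e hμ hadd₁ hadd₂ halt hnondeg hgal _ hℓ v hv s _ _ hxs hys h11 h12 h21 h22 hx0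
    exact KolyLocal.sub_zsmul_mem_torsionLocalKer_of_isotropic W K hK hsurj hc e hμ hadd₁ hadd₂ halt hnondeg hgal hℓ v hv
      s hxs hys h11 h12 h21 h22 hx0)

end Summit.BirchSwinnertonDyer.Rank1Residual.X11b.Three.Koly.Method2

end
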